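import Summits.Ventures.GridStability.Models.Polynomialise

/-!
# Relative-speed recast of the classical multimachine model (uniform damping; PARTITION A11′ fallback)

Venture GRIDFUSION, cell `run/shared/lean/pub/gridfusion/`, seat model-1. Companion of
`Polynomialise.lean` for the instances «WSCC9-postB-D0» and «WSCC9-postB-λ» (lead A11′ 17:31Z,
model-4 option C 17:43Z, model-1 pick 17:5xZ): when the damping ratio `λ = D_i/M_i` is UNIFORM
(including `λ = 0`), the relative speeds `ν_i = ω_i − ω_0` close the dynamics
(Kundu–Anghel ECC 2015 §6.1: relative speeds w.r.t. the reference generator under uniform `D/M`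
[corpus:paper:arxiv-1503.07541 p.10]); the common (COI-like) motion — a constant common
acceleration `a′` when the post-fault dispatch does not balance — drops out EXACTLY, so the printed
dispatch needs no modification beyond the A1 `t`-rounding (`P_i′ = e_i + M_i a′`).

Variables (`3n` of them): angle block as in `Polynomialise.lean` (`σ_{i+1} ↦ 2i`, `κ_{i+1} ↦ 2i+1`,
`i < n`), relative speeds `ν_{i+1} = ω_{i+1} − ω_0 ↦ 2n + i` (`i < n`). Recast (exact, `f(0) = 0`):
`dσ_i/dt = (1 − κ_i) ν_i`, `dκ_i/dt = σ_i ν_i`,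
`dν_i/dt = (e_i − P_{e,i}(z))/M_i − (e_0 − P_{e,0}(z))/M_0 − λ ν_i`, `e = Pprime`.

Contents: `pν`, `gσ gκ gν`, `gk`, `relField`, `toModelRel λ a′` (the real model: `ClassicalSwing`
with `D_i = λ M_i`, `P_i = e_i + M_i a′`), `embedRel`, atom lemmas, and the exact-embedding lemma
`hasDerivWithinAt_embedRel`. MODELLED as `ClassicalSwing.lean`; nothing here says a grid is stable.
-/

noncomputable section

open Real Finset
open Literature.Computation.Certificates
open Literature.Computation.Certificates.SOS
open Literature.Computation.Certificates.SOS.Poly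

namespace Summit.Ventures.GridStability.Models

namespace RecastData

variable {n : ℕ} (d : RecastData n) (lam : ℚ)

/-- Relative speed `ν_i = ω_i − ω_0` as a polynomial: `X (2n + (i−1))` for `i ≥ 1`, zero for the
reference. -/
def pν : Fin (n + 1) → Poly := Fin.cases [] fun i => X (2 * n + i.val)

/-- Relative recast `σ̇_i = (1 − κ_i) ν_i`, normalised. -/
def gσ (i : Fin (n + 1)) : Poly := Poly.norm (mul (pcos i) (pν i))

/-- Relative recast `κ̇_i = σ_i ν_i`, normalised. -/
def gκ (i : Fin (n + 1)) : Poly := Poly.norm (mul (pσ i) (pν i))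

/-- `(e_i − P_{e,i}(z))/M_i` — acceleration of machine `i` relative to the frame (polynomial). -/
def pacc (i : Fin (n + 1)) : Poly := smul (1 / d.M i) (add (C (d.Pprime i)) (neg (d.pPe i)))

/-- Relative recast `ν̇_i = (e_i − P_{e,i})/M_i − (e_0 − P_{e,0})/M_0 − λ ν_i`, normalised. -/
def gν (i : Fin (n + 1)) : Poly :=
  Poly.norm (add (add (d.pacc i) (neg (d.pacc 0))) (neg (smul lam (pν i))))

/-- Component function of the relative recast: `g_{2i} = σ̇_{i+1}`, `g_{2i+1} = κ̇_{i+1}`,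
`g_{2n+i} = ν̇_{i+1}` (`i < n`), zero beyond. -/
def gk (k : ℕ) : Poly :=
  if h : k < 2 * n then
    (if k % 2 = 0 then gσ (⟨k / 2 + 1, by omega⟩ : Fin (n + 1))
      else gκ (⟨k / 2 + 1, by omega⟩ : Fin (n + 1)))
  else if h' : k < 3 * n then d.gν lam ⟨k - 2 * n + 1, by omega⟩ else []

/-- The relative recast field `[g_0, …, g_{3n−1}]` (interface I2 for the uniform-damping instances). -/
def relField : List Poly := (List.range (3 * n)).map (d.gk lam)

/-- Component access: `relField[k] = gk k` (also beyond the end). -/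
theorem relField_getD (k : ℕ) : (d.relField lam).getD k [] = d.gk lam k := by
  unfold relField
  rw [List.getD_eq_getElem?_getD, List.getElem?_map]
  by_cases hk : k < 3 * n
  · simp [List.getElem?_range hk]
  · have h2 : ¬ k < 2 * n := by omega
    simp [gk, hk, h2]

/-- The real model whose RELATIVE dynamics the recast describes: `ClassicalSwing (n+1)` with the
exact network data, uniform damping `D_i = λ M_i`, and mechanical powers `P_i = e_i + M_i a′` for an
arbitrary common acceleration `a′ ∈ ℝ` (it cancels in every relative quantity). -/
def toModelRel (a : ℝ) : ClassicalSwing (n + 1) where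
  M i := d.M i; D i := lam * d.M i; P i := d.Pprime i + d.M i * a; E i := d.E i
  G i j := d.G i j; B i j := d.B i j

/-- The relative embedding: angle coordinates as in `embed`, then `2n + i ↦ ω_{i+1} − ω_0`
(`i < n`), else `0`. -/
def embedRel (δs : Fin (n + 1) → ℝ) (x : ClassicalSwing.State (n + 1)) (k : ℕ) : ℝ :=
  if h : k < 2 * n then
    (if k % 2 = 0 then sin (u δs x ⟨k / 2 + 1, by omega⟩)
      else 1 - cos (u δs x ⟨k / 2 + 1, by omega⟩))
  else if h' : k < 3 * n then x.2 ⟨k - 2 * n + 1, by omega⟩ - x.2 0 else 0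

variable (δs : Fin (n + 1) → ℝ) (x : ClassicalSwing.State (n + 1))

omit d lam in
/-- Angle coordinates of `embedRel` agree with `embed`. -/
theorem embedRel_of_lt {k : ℕ} (hk : k < 2 * n) : embedRel δs x k = embed δs x k := by
  simp [embedRel, embed, hk]

omit d lam in
/-- Speed coordinates of `embedRel`. -/
theorem embedRel_mid {k : ℕ} (hk : ¬ k < 2 * n) (hk' : k < 3 * n) :
    embedRel δs x k = x.2 ⟨k - 2 * n + 1, by omega⟩ - x.2 0 := by
  simp [embedRel, hk, hk']

omit d lam in
/-- `embedRel` vanishes beyond the last variable. -/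
theorem embedRel_high {k : ℕ} (hk' : ¬ k < 3 * n) : embedRel δs x k = 0 := by
  have hk : ¬ k < 2 * n := by omega
  simp [embedRel, hk, hk']

omit lam in
/-- `pσ i` on the relative embedding. -/
theorem eval_pσ_rel (i : Fin (n + 1)) : (pσ i).eval (embedRel δs x) = sin (u δs x i) := by
  cases i using Fin.cases with
  | zero => simp [pσ]
  | succ i =>
    rw [← eval_pσ δs x i.succ]
    simp [pσ, embedRel_of_lt δs x (show 2 * i.val < 2 * n by omega)]

omit lam in
/-- `pκ i` on the relative embedding. -/
theorem eval_pκ_rel (i : Fin (n + 1)) : (pκ i).eval (embedRel δs x) = 1 - cos (u δs x i) := by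
  cases i using Fin.cases with
  | zero => simp [pκ]
  | succ i =>
    rw [← eval_pκ δs x i.succ]
    simp [pκ, embedRel_of_lt δs x (show 2 * i.val + 1 < 2 * n by omega)]

omit d lam in
/-- `pν i` on the relative embedding is `ω_i − ω_0` (`0` for the reference). -/
theorem eval_pν (i : Fin (n + 1)) : (pν i).eval (embedRel δs x) = x.2 i - x.2 0 := by
  cases i using Fin.cases with
  | zero => simp [pν]
  | succ i =>
    have hk : ¬ 2 * n + i.val < 2 * n := by omega
    have hk' : 2 * n + i.val < 3 * n := by omega
    simp [pν, embedRel_mid δs x hk hk']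
    rfl

omit lam in
/-- `pcos i` on the relative embedding. -/
theorem eval_pcos_rel (i : Fin (n + 1)) : (pcos i).eval (embedRel δs x) = cos (u δs x i) := by
  simp [pcos, eval_neg, eval_pκ_rel]

omit lam in
/-- `psinΔ` on the relative embedding. -/
theorem eval_psinΔ_rel (i j : Fin (n + 1)) :
    (psinΔ i j).eval (embedRel δs x) = sin (u δs x i - u δs x j) := by
  simp [psinΔ, eval_neg, eval_pσ_rel, eval_pcos_rel, sin_sub]; ring

omit lam in
/-- `pcosΔ` on the relative embedding. -/
theorem eval_pcosΔ_rel (i j : Fin (n + 1)) :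
    (pcosΔ i j).eval (embedRel δs x) = cos (u δs x i - u δs x j) := by
  simp [pcosΔ, eval_pσ_rel, eval_pcos_rel, cos_sub]

variable {δs}

omit lam in
/-- Faithful sine on the relative embedding. -/
theorem eval_psinδ_rel (h : d.EqData δs) (i j : Fin (n + 1)) :
    (d.psinδ i j).eval (embedRel δs x) = sin (x.1 i - x.1 j) := by
  rw [angle_split (δs := δs) x i j, sin_add]
  simp [psinδ, eval_smul, eval_psinΔ_rel, eval_pcosΔ_rel, d.sd_cast h, d.cd_cast h]; ring

omit lam in
/-- Faithful cosine on the relative embedding. -/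
theorem eval_pcosδ_rel (h : d.EqData δs) (i j : Fin (n + 1)) :
    (d.pcosδ i j).eval (embedRel δs x) = cos (x.1 i - x.1 j) := by
  rw [angle_split (δs := δs) x i j, cos_add]
  simp [pcosδ, eval_smul, eval_neg, eval_psinΔ_rel, eval_pcosΔ_rel, d.sd_cast h, d.cd_cast h]
  ring

/-- Faithful electrical power on the relative embedding (= `ClassicalSwing.Pe` of `toModelRel`). -/
theorem eval_pPe_rel (h : d.EqData δs) (a : ℝ) (i : Fin (n + 1)) :
    (d.pPe i).eval (embedRel δs x) = (d.toModelRel lam a).Pe x.1 i := by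
  unfold pPe ClassicalSwing.Pe
  rw [eval_append, eval_flatMap, eval_C]
  have hset : ((List.finRange (n + 1)).filter (· ≠ i)).toFinset = univ.erase i := by
    ext j; simp [Finset.mem_erase, ne_comm]
  rw [← List.sum_toFinset _ ((List.nodup_finRange _).filter _), hset]
  simp [pPeTerm, eval_smul, d.eval_psinδ_rel x h, d.eval_pcosδ_rel x h, ClassicalSwing.Ccoef,
    ClassicalSwing.Dcoef, toModelRel, Cc, Dc]

/-- `pacc i` evaluates to `ω̇_i + λ ω_i − a′` of `toModelRel` (the machine's acceleration net of
damping and of the common acceleration). -/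
theorem eval_pacc (h : d.EqData δs) (a : ℝ) (i : Fin (n + 1)) (hM : d.M i ≠ 0) :
    (d.pacc i).eval (embedRel δs x) =
      ((d.toModelRel lam a).field x).2 i + (lam : ℝ) * x.2 i - a := by
  have hM' : (d.M i : ℝ) ≠ 0 := by exact_mod_cast hM
  have hf : ((d.toModelRel lam a).field x).2 i =
      ((d.Pprime i : ℝ) + d.M i * a - (d.toModelRel lam a).Pe x.1 i - lam * d.M i * x.2 i) / d.M i := rfl
  rw [hf]
  simp only [pacc, eval_smul, eval_add, eval_neg, eval_C, d.eval_pPe_rel lam x h a]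
  push_cast
  field_simp
  ring

/-- **Faithful `ν̇`**: `gν i` evaluates to `ω̇_i − ω̇_0` of the model `toModelRel λ a′`, for every
common acceleration `a′`. -/
theorem eval_gν (h : d.EqData δs) (a : ℝ) (i : Fin (n + 1)) (hM : ∀ j, d.M j ≠ 0) :
    (d.gν lam i).eval (embedRel δs x) =
      ((d.toModelRel lam a).field x).2 i - ((d.toModelRel lam a).field x).2 0 := by
  simp only [gν, eval_norm, eval_add, eval_neg, eval_smul, d.eval_pacc lam x h a _ (hM _), eval_pν]
  ring

omit lam in
/-- `gσ i` evaluates to `cos u_i · (ω_i − ω_0)`. -/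
theorem eval_gσ (i : Fin (n + 1)) :
    (gσ i).eval (embedRel δs x) = cos (u δs x i) * (x.2 i - x.2 0) := by
  simp only [gσ, eval_norm, eval_mul, eval_pcos_rel, eval_pν]

omit lam in
/-- `gκ i` evaluates to `sin u_i · (ω_i − ω_0)`. -/
theorem eval_gκ (i : Fin (n + 1)) :
    (gκ i).eval (embedRel δs x) = sin (u δs x i) * (x.2 i - x.2 0) := by
  simp only [gκ, eval_norm, eval_mul, eval_pσ_rel, eval_pν]

omit d lam in
/-- The constraints hold identically on the relative embedding. -/
theorem eval_hcon_rel (i : Fin n) : (hcon i).eval (embedRel δs x) = 0 := by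
  have h1 := embedRel_of_lt δs x (show 2 * i.val < 2 * n by omega)
  have h2 := embedRel_of_lt δs x (show 2 * i.val + 1 < 2 * n by omega)
  simp [hcon, eval_smul, h1, h2, embed_σ, embed_κ]
  nlinarith [sin_sq_add_cos_sq (u δs x i.succ)]

/-- **Exact embedding lemma, relative form (chain rule).** Along every solution `c` of
`toModelRel λ a′` on `s`, every relative recast coordinate satisfies `dz_k/dt = g_k(z)` within `s`. -/
theorem hasDerivWithinAt_embedRel (h : d.EqData δs) (hM : ∀ i, d.M i ≠ 0) (a : ℝ)
    {c : ℝ → ClassicalSwing.State (n + 1)} {s : Set ℝ}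
    (hc : (d.toModelRel lam a).IsSolutionOn c s) {t : ℝ} (ht : t ∈ s) (k : ℕ) :
    HasDerivWithinAt (fun τ => embedRel δs (c τ) k)
      (((d.relField lam).getD k []).eval (embedRel δs (c t))) s t := by
  rw [relField_getD]
  have hsol := hc t ht
  have h1 : ∀ j, HasDerivWithinAt (fun τ => (c τ).1 j) ((c t).2 j) s t := fun j => by
    have := hasDerivWithinAt_pi.1 hsol.hasFDerivWithinAt.fst.hasDerivWithinAt j
    simpa [ClassicalSwing.field] using this
  have h2 : ∀ j, HasDerivWithinAt (fun τ => (c τ).2 j) (((d.toModelRel lam a).field (c t)).2 j) s t :=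
    fun j => by
    have := hasDerivWithinAt_pi.1 hsol.hasFDerivWithinAt.snd.hasDerivWithinAt j
    simpa using this
  have hu : ∀ j, HasDerivWithinAt (fun τ => u δs (c τ) j) ((c t).2 j - (c t).2 0) s t := fun j => by
    simpa [u] using ((h1 j).sub (h1 0)).sub_const (δs j - δs 0)
  by_cases hk : k < 2 * n
  · by_cases hpar : k % 2 = 0
    · have e1 : ∀ y : ClassicalSwing.State (n + 1), embedRel δs y k = sin (u δs y ⟨k / 2 + 1, by omega⟩) :=
        fun y => by rw [embedRel_of_lt δs y hk, embed_even δs y hk hpar]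
      simp only [gk, hk, hpar, dif_pos, if_true, e1, eval_gσ]
      simpa [mul_comm] using (hu ⟨k / 2 + 1, by omega⟩).sin
    · have e1 : ∀ y : ClassicalSwing.State (n + 1),
          embedRel δs y k = 1 - cos (u δs y ⟨k / 2 + 1, by omega⟩) :=
        fun y => by rw [embedRel_of_lt δs y hk, embed_odd δs y hk hpar]
      simp only [gk, hk, hpar, dif_pos, if_false, e1, eval_gκ]
      simpa [mul_comm] using ((hu ⟨k / 2 + 1, by omega⟩).cos).const_sub 1
  · by_cases hk' : k < 3 * n
    · simp only [gk, hk, hk', dif_neg, dif_pos, not_false_eq_true, embedRel_mid δs _ hk hk',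
        d.eval_gν lam _ h a _ hM]
      exact (h2 _).sub (h2 0)
    · simp only [gk, hk, hk', dif_neg, not_false_eq_true, embedRel_high δs _ hk', eval_nil]
      exact hasDerivWithinAt_const _ _ _

end RecastData

end Summit.Ventures.GridStability.Models
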